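import Summits.AtomisticToContinuum.Crystallization.Theses.ReggeStarCoercivity
import Summits.AtomisticToContinuum.Crystallization.Theorems.ReggeStarCoercivityDefectFreeCrystallizesRouteBeta
import Summits.AtomisticToContinuum.Crystallization.Theorems.ReggeStarCoercivityDefectFreeCrystallizesAffineCompetitor
import Summits.AtomisticToContinuum.Crystallization.Theorems.ReggeStarCoercivityDefectFreeCrystallizesZeroMeanStress
import Summits.AtomisticToContinuum.Crystallization.Theorems.PalmUnimodularRigidityLayeredLawsSelectHcpDefs
import Summits.AtomisticToContinuum.Crystallization.Theorems.PalmUnimodularRigidityLayeredLawsSelectHcpRelaxedReference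
import Summits.AtomisticToContinuum.Crystallization.Theorems.PalmUnimodularRigidityLayeredLawsSelectHcpTubeMuGSC
import Summits.AtomisticToContinuum.Crystallization.Theorems.PalmUnimodularRigidityLayeredLawsSelectHcpForceBalance
import Summits.AtomisticToContinuum.Crystallization.Theorems.ExcessDecayLiouvilleCoarseGrainsHcpEnergySeries
import Summits.AtomisticToContinuum.Crystallization.Theorems.LayeredLawsSelectHcp.Negative.FccModel
import Summits.AtomisticToContinuum.Crystallization.Theorems.ChargedEnergyGap.Negative.BlocksBound
import Summits.AtomisticToContinuum.Crystallization.Theorems.PalmUnimodularRigidityCruxesToPalmRigidity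
import Literature.Probability.Process.PointStationaryLaw

/-!
# Route β of line `palm-good-law`, floor form (crux `ReggeStarCoercivity.DefectFreeCrystallizes`,
# item stmt-AtomisticToContinuum-13603; lead c6, skeleton v18)

The line's energy step R2a′ (`chartedFunnelToShells`: a minimising point-stationary law on the charted `1/20`-funnel has
`1 %`-good shells at scale `≤ 1` everywhere) is reduced, sorry-free, to its `e*`-FREE core R2a″ (`FunnelShellFloor`, the
hypothesis `hR2a''` below, stated in crux 9226's vocabulary: level `hcpE a₀ h₀` of the relaxed reference, ROOT shell, and the
`e*`-level structure of minimising laws as named inputs), using three law-level STRUCTURE THEOREMS of minimising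
point-stationary hard-core laws, two of them landed this cycle:

* `zeroMeanStress_of_minimising` — ZERO MEAN VIRIAL STRESS `E_P[Σ_y V′(‖y‖)⟨y, My⟩/‖y‖] = 0` for every matrix `M`
  (affine competitors are admissible point-stationary hard-core laws, `AffineCompetitor.stub_affineCompetitor`, so the landed
  floor `e_uni ≥ e*` (item 9229) bounds every affine image from below by `e* ≥ E_P[h]`; Fermat along `1 + tM`,
  `ZeroMeanStress.stub_zeroMeanStress_of_competitor`);
* `ae_forceBalance_of_minimising` — a.s. FORCE BALANCE at every point (minimising ⇒ a.s. Sütő `μ`GSC,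
  `LayeredLawsSelectHcp.ae_isMuGSC_of_hardCore`; `μ`GSC ⇒ equilibrium, `LayeredLawsSelectHcp.tube_muGSC_forceBalance`);
* the relaxed hcp reference `(a₀, h₀)` (`LayeredLawsSelectHcp.stub_relaxedReference`) with
  `e* ≤ e(hcp a₀ h₀) = hcpE a₀ h₀` (`iInf_le_hcpE`: `eStar_le` + `hcpEnergySeries_of_eq`).

Main results: `chartedFunnelToShells_of_funnelShellFloor` (R2a″ ⇒ R2a′) and
`defectFreeCrystallizes_of_funnelShellFloor` (R2a″ → crux 9226 `LayeredLawsSelectHcp` → the crux BY NAME, through the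
landed `RouteBeta.defectFreeCrystallizes_of_chartedFunnelToShells`).  So after this file the crux is CLOSED MODULO
{R2a″, crux 9226} in the tree.  All `[folklore]` bookkeeping over landed theorems; no new definitions.
-/

noncomputable section

open scoped ENNReal
open Filter Topology MeasureTheory

namespace Summit.AtomisticToContinuum.Crystallization.Theorems.PalmGoodLaw.RouteBetaFloor

open Summit.AtomisticToContinuum.Crystallization.Theses
open Summit.AtomisticToContinuum.Crystallization.Theorems.PalmUnimodularRigidity
open Summit.AtomisticToContinuum.Crystallization.Theorems.PalmUnimodularRigidity.LayeredLawsSelectHcp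
  (hcpE hcpQ stub_relaxedReference ae_isMuGSC_of_hardCore tube_muGSC_forceBalance)
open Literature.MathematicalPhysics.StatisticalMechanics Literature.Geometry.DiscreteGeometry
open Literature.Probability.Process

/-- **Zero mean virial stress of minimising laws.**  A minimising (`E_P[h] ≤ e*`) point-stationary `δ`-hard-core probability
law has `E_P[Σ_y V′(‖y‖)⟨y, My⟩/‖y‖] = 0` for every continuous linear `M` — from the landed
`AffineCompetitor.stub_affineCompetitor` (every affine image costs `≥ e* ≥ E_P[h]`) and
`ZeroMeanStress.stub_zeroMeanStress_of_competitor` (Fermat). [folklore] -/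
theorem zeroMeanStress_of_minimising {δ : ℝ} (hδ : 0 < δ) {P : Measure (Measure (EuclideanSpace ℝ (Fin 3)))}
    [IsProbabilityMeasure P] (hcore : ∀ᵐ μ ∂P, IsRootedHardCore δ μ) (hstat : IsPointStationaryLaw P)
    (hE : (∫ μ, (∫ y, lennardJones ‖y‖ ∂μ) / 2 ∂P) ≤ (⨅ Q : PeriodicConfiguration 3, Q.energyPerParticle lennardJones))
    (M : EuclideanSpace ℝ (Fin 3) →L[ℝ] EuclideanSpace ℝ (Fin 3)) :
    ∫ μ, (∫ y, deriv lennardJones ‖y‖ / ‖y‖ * inner ℝ y (M y) ∂μ) ∂P = 0 :=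
  ZeroMeanStress.stub_zeroMeanStress_of_competitor δ hδ P inferInstance hcore
    (fun A => hE.trans (AffineCompetitor.stub_affineCompetitor δ hδ P inferInstance hcore hstat A)) M

/-- **A.s. force balance of minimising laws.**  A minimising point-stationary `δ`-hard-core probability law is almost surely
carried by configurations in force balance at EVERY point (full infinite-range Lennard-Jones force, absolutely summable):
minimising ⇒ a.s. Sütő `μ`GSC at `e*` (`ae_isMuGSC_of_hardCore`) ⇒ equilibrium at every point (`tube_muGSC_forceBalance`).
[folklore] -/
theorem ae_forceBalance_of_minimising {δ : ℝ} (hδ : 0 < δ) {P : Measure (Measure (EuclideanSpace ℝ (Fin 3)))}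
    [IsProbabilityMeasure P] (hcore : ∀ᵐ μ ∂P, IsRootedHardCore δ μ) (hstat : IsPointStationaryLaw P)
    (hE : (∫ μ, (∫ y, lennardJones ‖y‖ ∂μ) / 2 ∂P) ≤ (⨅ Q : PeriodicConfiguration 3, Q.energyPerParticle lennardJones)) :
    ∀ᵐ μ ∂P, ∃ S : Set (EuclideanSpace ℝ (Fin 3)),
      μ = (Measure.count : Measure (EuclideanSpace ℝ (Fin 3))).restrict S ∧
      ∀ p ∈ S, HasSum (fun q : {q : EuclideanSpace ℝ (Fin 3) // q ∈ S ∧ q ≠ p} =>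
        (deriv lennardJones (dist p q.1) / dist p q.1) • (p - q.1)) 0 := by
  filter_upwards [hcore, ae_isMuGSC_of_hardCore hδ hcore hstat hE] with μ hc hg
  obtain ⟨S₀, -, hsep, rfl⟩ := hc
  obtain ⟨S, hS, hGSC⟩ := hg
  have hSS : S₀ = S :=
    Summit.AtomisticToContinuum.Crystallization.Theorems.LayeredLawsSelectHcp.Negative.FccModel.set_eq_of_count_restrict_eq hS
  subst hSS
  exact ⟨S₀, rfl, tube_muGSC_forceBalance δ _ hδ S₀ hsep hGSC⟩

/-- `e* ≤ hcpE a h` for `a, h ≠ 0`: the relaxed-hcp level dominates the periodic infimum (`hcpE a h` IS the energy per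
particle of `hcpPeriodicConfiguration`, third clause of the landed `hcpEnergySeries_of_eq` — the same one-liner as the landed
`SquareWellLayerCakeTwelveWithinOne.Closing.hcpE_eq_energyPerParticle`, inlined here to keep the import closure small — and
`eStar_le`). [folklore] -/
theorem iInf_le_hcpE {a h : ℝ} (ha : a ≠ 0) (hh : h ≠ 0) :
    (⨅ Q : PeriodicConfiguration 3, Q.energyPerParticle lennardJones) ≤ hcpE a h := by
  rw [show hcpE a h = (hcpPeriodicConfiguration ha hh).energyPerParticle lennardJones from
    ((Summit.AtomisticToContinuum.Crystallization.Theorems.ExcessDecayLiouvilleCoarseGrains.hcpEnergySeries_of_eq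
      a h ha hh hcpQ rfl).2.2).symm]
  exact Summit.AtomisticToContinuum.Crystallization.Theorems.ChargedEnergyGapNegative.eStar_le _

/-- **R2a″ ⇒ R2a′ (sorry-free reduction of the line's energy step to its `e*`-free core).**  If the FUNNEL SHELL FLOOR
holds — for the relaxed reference `(a₀,h₀)` (window + global `hcpE`-minimality as inputs), every point-stationary probability
law on rooted `δ`-hard-core configurations, a.s. carried by everywhere-`SetGood` Barlow-charted configurations, a.s. in force
balance at every point, with zero mean virial stress and mean root energy `≤ hcpE a₀ h₀`, has a.s. a `(1/100)`-good ROOT shell at a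
scale in `[9/10, 1]` — then every MINIMISING (`E_P[h] ≤ e*`) point-stationary hard-core law a.s. carried by everywhere-`SetGood`
Barlow-charted configurations is a.s. carried by configurations EVERY point of which has such a shell (verbatim the hypothesis of
crux 9227 / the shell clause of crux 9226).  Glue: `stub_relaxedReference`, `e* ≤ hcpE a₀ h₀`, `ae_forceBalance_of_minimising`,
`zeroMeanStress_of_minimising`, then the Aldous–Lyons lemma `ae_forall_map_sub_of_ae` (local finiteness from the hard core)
re-roots at every point. [folklore] -/
theorem chartedFunnelToShells_of_funnelShellFloor :
    (∀ a₀ h₀ : ℝ, 189 / 200 ≤ a₀ → a₀ ≤ 199 / 200 → 77 / 100 ≤ h₀ → h₀ ≤ 163 / 200 →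
      (∀ a h : ℝ, 0 < a → 0 < h → hcpE a₀ h₀ ≤ hcpE a h) →
      ∀ δ : ℝ, 0 < δ → ∀ P : Measure (Measure (EuclideanSpace ℝ (Fin 3))), IsProbabilityMeasure P →
        (∀ᵐ μ ∂P, IsRootedHardCore δ μ) → IsPointStationaryLaw P →
        (∀ᵐ μ ∂P, ∃ S : Set (EuclideanSpace ℝ (Fin 3)),
          μ = (Measure.count : Measure (EuclideanSpace ℝ (Fin 3))).restrict S ∧
          (∀ y ∈ S, SetGood S y) ∧
          ∃ s : ℤ → ℤ, IsHaggSeq s ∧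
            ∃ Φ : EuclideanSpace ℝ (Fin 3) → EuclideanSpace ℝ (Fin 3),
              Set.BijOn Φ (barlowStacking 1 (Real.sqrt (2 / 3)) s) S ∧
              ∀ p ∈ barlowStacking 1 (Real.sqrt (2 / 3)) s, ∀ q ∈ barlowStacking 1 (Real.sqrt (2 / 3)) s,
                (dist p q = 1 ↔ (0 < dist (Φ p) (Φ q) ∧ dist (Φ p) (Φ q) < 6 / 5))) →
        (∀ᵐ μ ∂P, ∃ S : Set (EuclideanSpace ℝ (Fin 3)),
          μ = (Measure.count : Measure (EuclideanSpace ℝ (Fin 3))).restrict S ∧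
          ∀ p ∈ S, HasSum (fun q : {q : EuclideanSpace ℝ (Fin 3) // q ∈ S ∧ q ≠ p} =>
            (deriv lennardJones (dist p q.1) / dist p q.1) • (p - q.1)) 0) →
        (∀ M : EuclideanSpace ℝ (Fin 3) →L[ℝ] EuclideanSpace ℝ (Fin 3),
          ∫ μ, (∫ y, deriv lennardJones ‖y‖ / ‖y‖ * inner ℝ y (M y) ∂μ) ∂P = 0) →
        (∫ μ, (∫ y, lennardJones ‖y‖ ∂μ) / 2 ∂P) ≤ hcpE a₀ h₀ →
        ∀ᵐ μ ∂P, ∃ a : ℝ, 9 / 10 ≤ a ∧ a ≤ 1 ∧ ∃ T : Finset (EuclideanSpace ℝ (Fin 3)),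
          (↑T : Set (EuclideanSpace ℝ (Fin 3))) =
            {y : EuclideanSpace ℝ (Fin 3) | μ {y} ≠ 0 ∧ y ≠ 0 ∧ ‖y‖ ≤ 5 / 4 * a} ∧
          (ShellCloseTo (a / 100) T (Finset.image (fun v : EuclideanSpace ℝ (Fin 3) => a • v) fccKissingPattern) ∨
            ShellCloseTo (a / 100) T (Finset.image (fun v : EuclideanSpace ℝ (Fin 3) => a • v) hcpKissingPattern))) →
    ∀ δ : ℝ, 0 < δ → ∀ P : Measure (Measure (EuclideanSpace ℝ (Fin 3))), IsProbabilityMeasure P →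
      (∀ᵐ μ ∂P, IsRootedHardCore δ μ) → IsPointStationaryLaw P →
      (∫ μ, (∫ y, lennardJones ‖y‖ ∂μ) / 2 ∂P) ≤
        (⨅ Q : PeriodicConfiguration 3, Q.energyPerParticle lennardJones) →
      (∀ᵐ μ ∂P, ∃ S : Set (EuclideanSpace ℝ (Fin 3)),
        μ = (Measure.count : Measure (EuclideanSpace ℝ (Fin 3))).restrict S ∧
        (∀ y ∈ S, SetGood S y) ∧
        ∃ s : ℤ → ℤ, IsHaggSeq s ∧
          ∃ Φ : EuclideanSpace ℝ (Fin 3) → EuclideanSpace ℝ (Fin 3),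
            Set.BijOn Φ (barlowStacking 1 (Real.sqrt (2 / 3)) s) S ∧
            ∀ p ∈ barlowStacking 1 (Real.sqrt (2 / 3)) s, ∀ q ∈ barlowStacking 1 (Real.sqrt (2 / 3)) s,
              (dist p q = 1 ↔ (0 < dist (Φ p) (Φ q) ∧ dist (Φ p) (Φ q) < 6 / 5))) →
      ∀ᵐ μ ∂P, ∃ S : Set (EuclideanSpace ℝ (Fin 3)),
        μ = (Measure.count : Measure (EuclideanSpace ℝ (Fin 3))).restrict S ∧
        ∀ x ∈ S, (∃ a : ℝ, 9 / 10 ≤ a ∧ a ≤ 1 ∧ ∃ T : Finset (EuclideanSpace ℝ (Fin 3)),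
          (↑T : Set (EuclideanSpace ℝ (Fin 3))) =
            (fun y : EuclideanSpace ℝ (Fin 3) => y - x) ''
              {y : EuclideanSpace ℝ (Fin 3) | y ∈ S ∧ y ≠ x ∧ dist y x ≤ 5 / 4 * a} ∧
          (ShellCloseTo (a / 100) T (Finset.image (fun v : EuclideanSpace ℝ (Fin 3) => a • v) fccKissingPattern) ∨
            ShellCloseTo (a / 100) T (Finset.image (fun v : EuclideanSpace ℝ (Fin 3) => a • v) hcpKissingPattern))) := by
  intro hR2a'' δ hδ P hP hcore hstat hE hchart
  -- the relaxed reference and `E_P[h] ≤ e* ≤ hcpE a₀ h₀`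
  obtain ⟨a₀, h₀, ha₁, ha₂, hh₁, hh₂, hmin⟩ := stub_relaxedReference
  have ha0 : 0 < a₀ := by linarith
  have hh0 : 0 < h₀ := by linarith
  have hlevel : (∫ μ, (∫ y, lennardJones ‖y‖ ∂μ) / 2 ∂P) ≤ hcpE a₀ h₀ :=
    hE.trans (iInf_le_hcpE ha0.ne' hh0.ne')
  -- the root shell from R2a″ fed with the `e*`-level structure
  have hroot := hR2a'' a₀ h₀ ha₁ ha₂ hh₁ hh₂ hmin δ hδ P hP hcore hstat hchart
    (ae_forceBalance_of_minimising hδ hcore hstat hE) (zeroMeanStress_of_minimising hδ hcore hstat hE) hlevel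
  -- hard-core configurations are locally finite
  have hlf : ∀ᵐ μ ∂P, ∀ n : ℕ,
      μ ((fun z : EuclideanSpace ℝ (Fin 3) => ⌊‖z‖⌋₊) ⁻¹' {n}) < ∞ := by
    filter_upwards [hcore] with μ hμ n
    obtain ⟨S, -, hsep, rfl⟩ := hμ
    exact count_restrict_floorNorm_preimage_lt_top hδ hsep n
  -- every point a.s. (Aldous–Lyons), and the re-rooted shell rewritten
  have hall := ae_forall_map_sub_of_ae hstat hlf hroot
  filter_upwards [hcore, hall] with μ hc ha
  obtain ⟨S, -, -, rfl⟩ := hc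
  refine ⟨S, rfl, fun y hy => ?_⟩
  obtain ⟨a, ha1, ha2, T, hT, hsh⟩ := ha y ((count_restrict_singleton_ne_zero_iff S y).2 hy)
  refine ⟨a, ha1, ha2, T, ?_, hsh⟩
  rw [hT, map_sub_count_restrict, shell_image_sub_eq]

/-- **The crux from R2a″ and crux 9226 (sorry-free): the line `palm-good-law` closes
`ReggeStarCoercivity.DefectFreeCrystallizes` MODULO {the funnel shell floor R2a″, crux 9226 `LayeredLawsSelectHcp`}** —
`chartedFunnelToShells_of_funnelShellFloor` followed by the landed route-β composition
`RouteBeta.defectFreeCrystallizes_of_chartedFunnelToShells` (P1 good law, R1 funnel chart at tolerance `1/20`, crux 9227, R3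
charging, item 2916 — all landed). [folklore] -/
theorem defectFreeCrystallizes_of_funnelShellFloor
    (hR2a'' : ∀ a₀ h₀ : ℝ, 189 / 200 ≤ a₀ → a₀ ≤ 199 / 200 → 77 / 100 ≤ h₀ → h₀ ≤ 163 / 200 →
      (∀ a h : ℝ, 0 < a → 0 < h → hcpE a₀ h₀ ≤ hcpE a h) →
      ∀ δ : ℝ, 0 < δ → ∀ P : Measure (Measure (EuclideanSpace ℝ (Fin 3))), IsProbabilityMeasure P →
        (∀ᵐ μ ∂P, IsRootedHardCore δ μ) → IsPointStationaryLaw P →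
        (∀ᵐ μ ∂P, ∃ S : Set (EuclideanSpace ℝ (Fin 3)),
          μ = (Measure.count : Measure (EuclideanSpace ℝ (Fin 3))).restrict S ∧
          (∀ y ∈ S, SetGood S y) ∧
          ∃ s : ℤ → ℤ, IsHaggSeq s ∧
            ∃ Φ : EuclideanSpace ℝ (Fin 3) → EuclideanSpace ℝ (Fin 3),
              Set.BijOn Φ (barlowStacking 1 (Real.sqrt (2 / 3)) s) S ∧
              ∀ p ∈ barlowStacking 1 (Real.sqrt (2 / 3)) s, ∀ q ∈ barlowStacking 1 (Real.sqrt (2 / 3)) s,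
                (dist p q = 1 ↔ (0 < dist (Φ p) (Φ q) ∧ dist (Φ p) (Φ q) < 6 / 5))) →
        (∀ᵐ μ ∂P, ∃ S : Set (EuclideanSpace ℝ (Fin 3)),
          μ = (Measure.count : Measure (EuclideanSpace ℝ (Fin 3))).restrict S ∧
          ∀ p ∈ S, HasSum (fun q : {q : EuclideanSpace ℝ (Fin 3) // q ∈ S ∧ q ≠ p} =>
            (deriv lennardJones (dist p q.1) / dist p q.1) • (p - q.1)) 0) →
        (∀ M : EuclideanSpace ℝ (Fin 3) →L[ℝ] EuclideanSpace ℝ (Fin 3),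
          ∫ μ, (∫ y, deriv lennardJones ‖y‖ / ‖y‖ * inner ℝ y (M y) ∂μ) ∂P = 0) →
        (∫ μ, (∫ y, lennardJones ‖y‖ ∂μ) / 2 ∂P) ≤ hcpE a₀ h₀ →
        ∀ᵐ μ ∂P, ∃ a : ℝ, 9 / 10 ≤ a ∧ a ≤ 1 ∧ ∃ T : Finset (EuclideanSpace ℝ (Fin 3)),
          (↑T : Set (EuclideanSpace ℝ (Fin 3))) =
            {y : EuclideanSpace ℝ (Fin 3) | μ {y} ≠ 0 ∧ y ≠ 0 ∧ ‖y‖ ≤ 5 / 4 * a} ∧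
          (ShellCloseTo (a / 100) T (Finset.image (fun v : EuclideanSpace ℝ (Fin 3) => a • v) fccKissingPattern) ∨
            ShellCloseTo (a / 100) T (Finset.image (fun v : EuclideanSpace ℝ (Fin 3) => a • v) hcpKissingPattern)))
    (h9226 : PalmUnimodularRigidity.LayeredLawsSelectHcp) :
    Summit.AtomisticToContinuum.Crystallization.Theses.ReggeStarCoercivity.DefectFreeCrystallizes :=
  RouteBeta.defectFreeCrystallizes_of_chartedFunnelToShells (chartedFunnelToShells_of_funnelShellFloor hR2a'') h9226

end Summit.AtomisticToContinuum.Crystallization.Theorems.PalmGoodLaw.RouteBetaFloor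

end
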